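import Mathlib.Analysis.SpecialFunctions.SmoothTransition
import Mathlib.Analysis.InnerProductSpace.Calculus
import Mathlib.Analysis.InnerProductSpace.PiL2
import Mathlib.Analysis.Calculus.Deriv.Prod
import Mathlib.Analysis.Calculus.Deriv.Mul
import Mathlib.Analysis.Calculus.Deriv.Comp
import Mathlib.Analysis.Calculus.Deriv.MeanValue
import Mathlib.Analysis.Calculus.Deriv.Inv
import Literature.Topology.FourManifolds.BandSum
import HarnessLib

/-!
# Smooth steps and planar arches with prescribed ends

Topic `Literature/Topology/FourManifolds` (trunk T-4MAN). Real-analysis toolkit for building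
knots and band-sum presentations by explicit formulas (decomposition of the named fact
`Literature.Topology.FourManifolds.Knot.Schubert1949_normalPosition`, tame normal form of band data): the planar arcs of a
`Literature.Topology.FourManifolds.BandData` (`lowerArc`, `upperArc`) have to be produced as `C^∞` embedded regular curves in
the model square with prescribed behaviour at their ends. Everything here is proved:

* `Real.smoothTransition` is strictly increasing on `[0, 1]` with positive derivative on `(0, 1)`
  (`deriv_smoothTransition_pos`, `strictMonoOn_smoothTransition`);
* `Literature.Topology.FourManifolds.smoothStep a b`, the rescaled transition (`0` left of `a`, `1` right of `b`, strictly
  increasing in between), with its calculus;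
* `Literature.Topology.FourManifolds.exists_planarArch` — **planar arches with prescribed ends**: given `C^∞` functions
  `f` (increasing near `θ₁`) and `g` (decreasing near `θ₂`), there is a `C^∞` curve
  `c : ℝ → ℝ²` equal to `θ ↦ (0, f θ)` for `θ ≤ θ₁ + ε` and to `θ ↦ (1, g θ)` for `θ ≥ θ₂ - ε`,
  injective and regular on `[θ₁, θ₂]`, with first coordinate in `(0, 1)` strictly in between and
  second coordinate between `f θ` and `g θ`: `c θ = (χ₁ θ, (1 - χ₂ θ) f θ + χ₂ θ g θ)` for two
  nested smooth steps `χ₁`, `χ₂`.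

## References

Standard real analysis; all statements are `[folklore]`. Mathlib: `Real.smoothTransition`,
`expNegInvGlue` (`Mathlib.Analysis.SpecialFunctions.SmoothTransition`), `contDiff_euclidean`.
-/

open scoped ContDiff Topology
open Function Set Real

noncomputable section

namespace Literature.Topology.FourManifolds

/-- Local notation: `𝔼 n` is the model Euclidean space `EuclideanSpace ℝ (Fin n)`. -/
local notation "𝔼 " n:arg => EuclideanSpace ℝ (Fin n)

/-! ### `Real.smoothTransition` is strictly increasing on `[0, 1]` -/

/-- The derivative of `expNegInvGlue` is `x⁻² e(x)` (at every `x`; both sides vanish for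
`x ≤ 0`, with Mathlib's `0⁻¹ = 0`). [folklore] -/
theorem hasDerivAt_expNegInvGlue (x : ℝ) :
    HasDerivAt expNegInvGlue ((x ^ 2)⁻¹ * expNegInvGlue x) x := by
  have h := expNegInvGlue.hasDerivAt_polynomial_eval_inv_mul 1 x
  simp only [Polynomial.eval_one, one_mul, Polynomial.derivative_one, sub_zero, mul_one,
    Polynomial.eval_pow, Polynomial.eval_X, inv_pow] at h
  exact h

/-- `expNegInvGlue` is differentiable. [folklore] -/
theorem differentiable_expNegInvGlue : Differentiable ℝ expNegInvGlue :=
  (expNegInvGlue.contDiff (n := 1)).differentiable one_ne_zero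

/-- The derivative of `expNegInvGlue` is nonnegative. [folklore] -/
theorem deriv_expNegInvGlue_nonneg (x : ℝ) : 0 ≤ deriv expNegInvGlue x :=
  (differentiable_expNegInvGlue x).hasDerivAt.nonneg_of_monotone expNegInvGlue.monotone

/-- The derivative of `expNegInvGlue` is positive at `x > 0`. [folklore] -/
theorem deriv_expNegInvGlue_pos {x : ℝ} (hx : 0 < x) : 0 < deriv expNegInvGlue x := by
  rw [(hasDerivAt_expNegInvGlue x).deriv]
  exact mul_pos (by positivity) (expNegInvGlue.pos_of_pos hx)

/-- **`smoothTransition` has positive derivative on `(0, 1)`** (quotient rule: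
`(e/(e + ẽ))' = (e' ẽ + e ẽ')/(e + ẽ)²` with `ẽ (x) = e (1 - x)`). [folklore] -/
theorem deriv_smoothTransition_pos {x : ℝ} (hx0 : 0 < x) (hx1 : x < 1) :
    0 < deriv smoothTransition x := by
  set e := expNegInvGlue with he
  have hd : ∀ y, HasDerivAt e (deriv e y) y := fun y ↦ (differentiable_expNegInvGlue y).hasDerivAt
  have h1 : HasDerivAt (fun y ↦ e (1 - y)) (deriv e (1 - x) * -1) x :=
    (hd (1 - x)).comp x ((hasDerivAt_id x).const_sub 1)
  have hden : HasDerivAt (fun y ↦ e y + e (1 - y)) (deriv e x + deriv e (1 - x) * -1) x :=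
    (hd x).add h1
  have hpos : 0 < e x + e (1 - x) := smoothTransition.pos_denom x
  have hquot : HasDerivAt smoothTransition
      ((deriv e x * (e x + e (1 - x)) - e x * (deriv e x + deriv e (1 - x) * -1)) /
        (e x + e (1 - x)) ^ 2) x :=
    (hd x).fun_div hden hpos.ne'
  rw [hquot.deriv]
  apply div_pos _ (by positivity)
  have hex : 0 < e x := expNegInvGlue.pos_of_pos hx0
  have he1 : 0 < e (1 - x) := expNegInvGlue.pos_of_pos (by linarith)
  have hdx : 0 < deriv e x := deriv_expNegInvGlue_pos hx0
  have hd1 : 0 < deriv e (1 - x) := deriv_expNegInvGlue_pos (by linarith)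
  nlinarith

/-- `smoothTransition` is strictly increasing on `[0, 1]`. [folklore] -/
theorem strictMonoOn_smoothTransition : StrictMonoOn smoothTransition (Icc 0 1) := by
  refine strictMonoOn_of_deriv_pos (convex_Icc 0 1) smoothTransition.continuous.continuousOn ?_
  intro x hx
  rw [interior_Icc] at hx
  exact deriv_smoothTransition_pos hx.1 hx.2

/-! ### Smooth steps -/

/-- The **smooth step** from `a` to `b`: `smoothTransition ((x - a)/(b - a))`, equal to `0` for
`x ≤ a`, to `1` for `x ≥ b` and strictly increasing on `[a, b]` (for `a < b`). [folklore] -/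
def smoothStep (a b x : ℝ) : ℝ := smoothTransition ((x - a) / (b - a))

section SmoothStep

variable {a b : ℝ}

/-- The smooth step is `0` left of `a`. [folklore] -/
theorem smoothStep_of_le (hab : a < b) {x : ℝ} (hx : x ≤ a) : smoothStep a b x = 0 :=
  smoothTransition.zero_of_nonpos (div_nonpos_of_nonpos_of_nonneg (by linarith) (by linarith))

/-- The smooth step is `1` right of `b`. [folklore] -/
theorem smoothStep_of_ge (hab : a < b) {x : ℝ} (hx : b ≤ x) : smoothStep a b x = 1 :=
  smoothTransition.one_of_one_le ((one_le_div (by linarith)).2 (by linarith))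

/-- The smooth step takes values in `[0, 1]`. [folklore] -/
theorem smoothStep_mem_Icc (a b x : ℝ) : smoothStep a b x ∈ Icc 0 1 :=
  ⟨smoothTransition.nonneg _, smoothTransition.le_one _⟩

/-- Strictly between `a` and `b` the smooth step lies in `(0, 1)`. [folklore] -/
theorem smoothStep_mem_Ioo (hab : a < b) {x : ℝ} (hx : x ∈ Ioo a b) : smoothStep a b x ∈ Ioo 0 1 :=
  ⟨smoothTransition.pos_of_pos (div_pos (by linarith [hx.1]) (by linarith)),
    smoothTransition.lt_one_of_lt_one ((div_lt_one (by linarith)).2 (by linarith [hx.2]))⟩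

/-- The smooth step is `C^∞` in `x`. [folklore] -/
theorem contDiff_smoothStep (a b : ℝ) : ContDiff ℝ ∞ (smoothStep a b) :=
  smoothTransition.contDiff.comp ((contDiff_id.sub contDiff_const).div_const _)

/-- The smooth step is continuous. [folklore] -/
theorem continuous_smoothStep (a b : ℝ) : Continuous (smoothStep a b) :=
  (contDiff_smoothStep a b).continuous

/-- The smooth step is differentiable. [folklore] -/
theorem differentiable_smoothStep (a b : ℝ) : Differentiable ℝ (smoothStep a b) :=
  (contDiff_smoothStep a b).differentiable (by simp)

/-- The chain rule for the smooth step. [folklore] -/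
theorem hasDerivAt_smoothStep (a b x : ℝ) :
    HasDerivAt (smoothStep a b) (deriv smoothTransition ((x - a) / (b - a)) * (b - a)⁻¹) x := by
  have hd : HasDerivAt smoothTransition (deriv smoothTransition ((x - a) / (b - a)))
      ((x - a) / (b - a)) :=
    ((smoothTransition.contDiff (n := 1)).differentiable one_ne_zero _).hasDerivAt
  have hl : HasDerivAt (fun y : ℝ ↦ (y - a) / (b - a)) (b - a)⁻¹ x := by
    simpa [div_eq_mul_inv] using ((hasDerivAt_id x).sub_const a).mul_const (b - a)⁻¹
  exact hd.comp x hl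

/-- The smooth step has positive derivative strictly between `a` and `b`. [folklore] -/
theorem deriv_smoothStep_pos (hab : a < b) {x : ℝ} (hx : x ∈ Ioo a b) : 0 < deriv (smoothStep a b) x := by
  rw [(hasDerivAt_smoothStep a b x).deriv]
  refine mul_pos (deriv_smoothTransition_pos (div_pos (by linarith [hx.1]) (by linarith))
    ((div_lt_one (by linarith)).2 (by linarith [hx.2]))) (inv_pos.2 (by linarith))

/-- The smooth step has nonnegative derivative. [folklore] -/
theorem deriv_smoothStep_nonneg (hab : a < b) (x : ℝ) : 0 ≤ deriv (smoothStep a b) x := by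
  rw [(hasDerivAt_smoothStep a b x).deriv]
  have hd : 0 ≤ deriv smoothTransition ((x - a) / (b - a)) :=
    (((smoothTransition.contDiff (n := 1)).differentiable one_ne_zero) _).hasDerivAt.nonneg_of_monotone
      smoothTransition.monotone
  exact mul_nonneg hd (inv_nonneg.2 (by linarith))

/-- Left of `a` (strictly) the smooth step has derivative `0`. [folklore] -/
theorem deriv_smoothStep_of_lt (hab : a < b) {x : ℝ} (hx : x < a) : deriv (smoothStep a b) x = 0 := by
  have : smoothStep a b =ᶠ[𝓝 x] fun _ ↦ 0 :=
    Filter.eventuallyEq_of_mem (Iio_mem_nhds hx) fun y hy ↦ smoothStep_of_le hab (le_of_lt hy)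
  rw [this.deriv_eq, deriv_const]

/-- Right of `b` (strictly) the smooth step has derivative `0`. [folklore] -/
theorem deriv_smoothStep_of_gt (hab : a < b) {x : ℝ} (hx : b < x) : deriv (smoothStep a b) x = 0 := by
  have : smoothStep a b =ᶠ[𝓝 x] fun _ ↦ 1 :=
    Filter.eventuallyEq_of_mem (Ioi_mem_nhds hx) fun y hy ↦ smoothStep_of_ge hab (le_of_lt hy)
  rw [this.deriv_eq, deriv_const]

/-- At `a` and at `b` the smooth step has derivative `0` (it is flat there: the derivative is
continuous, `≥ 0`, and `0` on one side). [folklore] -/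
theorem deriv_smoothStep_left (a b : ℝ) : deriv (smoothStep a b) a = 0 := by
  rw [(hasDerivAt_smoothStep a b a).deriv, sub_self, zero_div]
  have : deriv smoothTransition 0 = 0 := by
    have hc : ContinuousAt (deriv smoothTransition) 0 :=
      ((smoothTransition.contDiff (n := 1)).continuous_deriv le_rfl).continuousAt
    have hl : Filter.Tendsto (deriv smoothTransition) (𝓝[<] 0) (𝓝 0) := by
      apply tendsto_const_nhds.congr'
      filter_upwards [self_mem_nhdsWithin] with y hy
      have : smoothTransition =ᶠ[𝓝 y] fun _ ↦ 0 :=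
        Filter.eventuallyEq_of_mem (Iio_mem_nhds hy) fun z hz ↦
          smoothTransition.zero_of_nonpos (le_of_lt hz)
      rw [this.deriv_eq, deriv_const]
    exact tendsto_nhds_unique (hc.tendsto.mono_left nhdsWithin_le_nhds) hl
  rw [this, zero_mul]

/-- At `b` the smooth step has derivative `0`. [folklore] -/
theorem deriv_smoothStep_right (hab : a < b) : deriv (smoothStep a b) b = 0 := by
  rw [(hasDerivAt_smoothStep a b b).deriv, div_self (by linarith : b - a ≠ 0)]
  have : deriv smoothTransition 1 = 0 := by
    have hc : ContinuousAt (deriv smoothTransition) 1 :=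
      ((smoothTransition.contDiff (n := 1)).continuous_deriv le_rfl).continuousAt
    have hl : Filter.Tendsto (deriv smoothTransition) (𝓝[>] 1) (𝓝 0) := by
      apply tendsto_const_nhds.congr'
      filter_upwards [self_mem_nhdsWithin] with y hy
      have : smoothTransition =ᶠ[𝓝 y] fun _ ↦ 1 :=
        Filter.eventuallyEq_of_mem (Ioi_mem_nhds hy) fun z hz ↦
          smoothTransition.one_of_one_le (le_of_lt hz)
      rw [this.deriv_eq, deriv_const]
    exact tendsto_nhds_unique (hc.tendsto.mono_left nhdsWithin_le_nhds) hl
  rw [this, zero_mul]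

/-- The smooth step is strictly increasing on `[a, b]`. [folklore] -/
theorem strictMonoOn_smoothStep (hab : a < b) : StrictMonoOn (smoothStep a b) (Icc a b) := by
  intro x hx y hy hxy
  refine strictMonoOn_smoothTransition ⟨?_, ?_⟩ ⟨?_, ?_⟩ ?_
  · exact div_nonneg (by linarith [hx.1]) (by linarith)
  · exact (div_le_one (by linarith)).2 (by linarith [hx.2])
  · exact div_nonneg (by linarith [hy.1]) (by linarith)
  · exact (div_le_one (by linarith)).2 (by linarith [hy.2])
  · exact div_lt_div_of_pos_right (by linarith) (by linarith)

/-- The smooth step is monotone. [folklore] -/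
theorem monotone_smoothStep (hab : a ≤ b) : Monotone (smoothStep a b) := fun x y hxy ↦
  smoothTransition.monotone (div_le_div_of_nonneg_right (by linarith) (by linarith))

end SmoothStep

/-! ### Planar arches with prescribed ends -/

/-- A convex combination of two reals lies between them. [folklore] -/
theorem combo_mem_uIcc {lam p q : ℝ} (h0 : 0 ≤ lam) (h1 : lam ≤ 1) :
    (1 - lam) * p + lam * q ∈ uIcc p q := by
  rcases le_total p q with hpq | hpq
  · rw [uIcc_of_le hpq]; constructor <;> nlinarith
  · rw [uIcc_of_ge hpq]; constructor <;> nlinarith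

/-- Coordinates of the derivative of a planar curve written with `pt2`. [folklore] -/
theorem hasDerivAt_pt2 {u v : ℝ → ℝ} {u' v' θ : ℝ} (hu : HasDerivAt u u' θ) (hv : HasDerivAt v v' θ) :
    HasDerivAt (fun x ↦ pt2 (u x) (v x)) (pt2 u' v') θ := by
  have key : HasDerivAt (fun x ↦ (WithLp.toLp 2 ![u x, v x] : 𝔼 2)) (WithLp.toLp 2 ![u', v']) θ := by
    have hpi : HasDerivAt (fun x ↦ (![u x, v x] : Fin 2 → ℝ)) ![u', v'] θ := by
      rw [hasDerivAt_pi]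
      intro i
      fin_cases i
      · exact hu
      · exact hv
    exact (PiLp.continuousLinearEquiv 2 ℝ (fun _ : Fin 2 ↦ ℝ)).symm.hasFDerivAt.comp_hasDerivAt θ hpi
  exact key

/-- **Planar arches with prescribed ends.** Let `f, g : ℝ → ℝ` be `C^∞`, with `f' > 0` on
`[θ₁, θ₁ + 2ε]` and `g' < 0` on `[θ₂ - 2ε, θ₂]`, where `θ₁ + 2ε < θ₂ - 2ε`. Then the curve
`c θ = (χ₁ θ, (1 - χ₂ θ) f θ + χ₂ θ g θ)`, for the smooth steps `χ₁` from `θ₁ + ε` to `θ₂ - ε` and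
`χ₂` from `θ₁ + 2ε` to `θ₂ - 2ε`, is `C^∞`, equals `(0, f θ)` for `θ ≤ θ₁ + ε` and `(1, g θ)` for
`θ ≥ θ₂ - ε`, has first coordinate in `(0, 1)` strictly in between (and in `[0, 1]` always) and
second coordinate between `f θ` and `g θ`, and is injective and regular (on all of `ℝ`, granted
`f' > 0` left of `θ₁ + 2ε` and `g' < 0` right of `θ₂ - 2ε`): on the ends the second coordinate
is `f`, resp. `g` (strictly monotone), in the middle the first coordinate is strictly increasing.
[folklore] -/
theorem exists_planarArch {θ₁ θ₂ ε : ℝ} (hε : 0 < ε) (hθ : θ₁ + 2 * ε < θ₂ - 2 * ε)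
    {f g : ℝ → ℝ} (hf : ContDiff ℝ ∞ f) (hg : ContDiff ℝ ∞ g)
    (hf' : ∀ θ, θ ≤ θ₁ + 2 * ε → 0 < deriv f θ)
    (hg' : ∀ θ, θ₂ - 2 * ε ≤ θ → deriv g θ < 0) :
    ∃ c : ℝ → 𝔼 2, ContDiff ℝ ∞ c ∧
      (∀ θ, θ ≤ θ₁ + ε → c θ = pt2 0 (f θ)) ∧
      (∀ θ, θ₂ - ε ≤ θ → c θ = pt2 1 (g θ)) ∧
      (∀ θ ∈ Ioo (θ₁ + ε) (θ₂ - ε), c θ 0 ∈ Ioo (0 : ℝ) 1) ∧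
      (∀ θ, c θ 0 ∈ Icc (0 : ℝ) 1) ∧
      (∀ θ, c θ 1 ∈ uIcc (f θ) (g θ)) ∧
      Injective c ∧
      ∀ θ, deriv c θ ≠ 0 := by
  have h1 : θ₁ + ε < θ₂ - ε := by linarith
  have h2 : θ₁ + 2 * ε < θ₂ - 2 * ε := hθ
  set χ₁ := smoothStep (θ₁ + ε) (θ₂ - ε) with hχ₁
  set χ₂ := smoothStep (θ₁ + 2 * ε) (θ₂ - 2 * ε) with hχ₂
  set v : ℝ → ℝ := fun θ ↦ (1 - χ₂ θ) * f θ + χ₂ θ * g θ with hv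
  set c : ℝ → 𝔼 2 := fun θ ↦ pt2 (χ₁ θ) (v θ) with hc
  have hc0 : ∀ θ, c θ 0 = χ₁ θ := fun θ ↦ rfl
  have hc1 : ∀ θ, c θ 1 = v θ := fun θ ↦ rfl
  -- smoothness
  have hχ₁s : ContDiff ℝ ∞ χ₁ := contDiff_smoothStep _ _
  have hχ₂s : ContDiff ℝ ∞ χ₂ := contDiff_smoothStep _ _
  have hvs : ContDiff ℝ ∞ v := ((contDiff_const.sub hχ₂s).mul hf).add (hχ₂s.mul hg)
  have hcs : ContDiff ℝ ∞ c := by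
    rw [contDiff_euclidean]
    intro i
    fin_cases i
    · exact hχ₁s
    · exact hvs
  -- values of the steps
  have hχ₂0 : ∀ θ, θ ≤ θ₁ + 2 * ε → χ₂ θ = 0 := fun θ hθ' ↦ smoothStep_of_le h2 hθ'
  have hχ₂1 : ∀ θ, θ₂ - 2 * ε ≤ θ → χ₂ θ = 1 := fun θ hθ' ↦ smoothStep_of_ge h2 hθ'
  have hχ₁0 : ∀ θ, θ ≤ θ₁ + ε → χ₁ θ = 0 := fun θ hθ' ↦ smoothStep_of_le h1 hθ'
  have hχ₁1 : ∀ θ, θ₂ - ε ≤ θ → χ₁ θ = 1 := fun θ hθ' ↦ smoothStep_of_ge h1 hθ'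
  have hvf : ∀ θ, θ ≤ θ₁ + 2 * ε → v θ = f θ := fun θ hθ' ↦ by
    simp only [hv, hχ₂0 θ hθ']; ring
  have hvg : ∀ θ, θ₂ - 2 * ε ≤ θ → v θ = g θ := fun θ hθ' ↦ by
    simp only [hv, hχ₂1 θ hθ']; ring
  -- the two end formulas
  have hleft : ∀ θ, θ ≤ θ₁ + ε → c θ = pt2 0 (f θ) := fun θ hθ' ↦ by
    simp only [hc, hχ₁0 θ hθ', hvf θ (by linarith)]
  have hright : ∀ θ, θ₂ - ε ≤ θ → c θ = pt2 1 (g θ) := fun θ hθ' ↦ by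
    simp only [hc, hχ₁1 θ hθ', hvg θ (by linarith)]
  -- monotonicity of the pieces
  have hfm : StrictMonoOn f (Iic (θ₁ + 2 * ε)) := by
    refine strictMonoOn_of_deriv_pos (convex_Iic _) hf.continuous.continuousOn fun x hx ↦ ?_
    rw [interior_Iic] at hx
    exact hf' x (le_of_lt hx)
  have hgm : StrictAntiOn g (Ici (θ₂ - 2 * ε)) := by
    refine strictAntiOn_of_deriv_neg (convex_Ici _) hg.continuous.continuousOn fun x hx ↦ ?_
    rw [interior_Ici] at hx
    exact hg' x (le_of_lt hx)
  have hχ₁m : StrictMonoOn χ₁ (Icc (θ₁ + ε) (θ₂ - ε)) := strictMonoOn_smoothStep h1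
  -- injectivity
  have key : ∀ s t, s < t → c s ≠ c t := by
    intro s t hst heq
    have hu : χ₁ s = χ₁ t := by rw [← hc0, ← hc0, heq]
    have hvst : v s = v t := by rw [← hc1, ← hc1, heq]
    by_cases hA : t ≤ θ₁ + ε
    · have := hfm (show s ∈ Iic (θ₁ + 2 * ε) by simp only [mem_Iic]; linarith)
        (show t ∈ Iic (θ₁ + 2 * ε) by simp only [mem_Iic]; linarith) hst
      rw [hvf s (by linarith), hvf t (by linarith)] at hvst
      exact this.ne hvst
    by_cases hB : θ₂ - ε ≤ s
    · have := hgm (show s ∈ Ici (θ₂ - 2 * ε) by simp only [mem_Ici]; linarith)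
        (show t ∈ Ici (θ₂ - 2 * ε) by simp only [mem_Ici]; linarith) hst
      rw [hvg s (by linarith), hvg t (by linarith)] at hvst
      exact this.ne' hvst
    push Not at hA hB
    -- the middle: `χ₁` separates
    have hs' : χ₁ s = χ₁ (max s (θ₁ + ε)) := by
      rcases le_total s (θ₁ + ε) with h | h
      · rw [max_eq_right h, hχ₁0 s h, hχ₁0 _ le_rfl]
      · rw [max_eq_left h]
    have ht' : χ₁ t = χ₁ (min t (θ₂ - ε)) := by
      rcases le_total t (θ₂ - ε) with h | h
      · rw [min_eq_left h]
      · rw [min_eq_right h, hχ₁1 t h, hχ₁1 _ le_rfl]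
    have hlt : max s (θ₁ + ε) < min t (θ₂ - ε) :=
      lt_min (max_lt hst hA) (max_lt hB h1)
    have := hχ₁m ⟨le_max_right _ _, (le_of_lt hlt).trans (min_le_right _ _)⟩
      ⟨(le_max_right _ _).trans (le_of_lt hlt), min_le_right _ _⟩ hlt
    rw [← hs', ← ht'] at this
    exact this.ne hu
  have hinj : Injective c := by
    intro s t hst
    rcases lt_trichotomy s t with h | h | h
    · exact absurd hst (key s t h)
    · exact h
    · exact absurd hst.symm (key t s h)
  -- regularity
  have hderiv : ∀ θ, HasDerivAt c (pt2 (deriv χ₁ θ) (deriv v θ)) θ := fun θ ↦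
    hasDerivAt_pt2 ((differentiable_smoothStep _ _ θ).hasDerivAt)
      ((hvs.differentiable (by simp) θ).hasDerivAt)
  have hreg : ∀ θ, deriv c θ ≠ 0 := by
    intro θ h0
    rw [(hderiv θ).deriv] at h0
    have hd0 : deriv χ₁ θ = 0 := by simpa using congrArg (fun w : 𝔼 2 ↦ w 0) h0
    have hd1 : deriv v θ = 0 := by simpa using congrArg (fun w : 𝔼 2 ↦ w 1) h0
    by_cases hA : θ < θ₁ + 2 * ε
    · have hev : v =ᶠ[𝓝 θ] f :=
        Filter.eventuallyEq_of_mem (Iio_mem_nhds hA) fun y hy ↦ hvf y (le_of_lt hy)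
      rw [hev.deriv_eq] at hd1
      exact (hf' θ (le_of_lt hA)).ne' hd1
    by_cases hB : θ₂ - 2 * ε < θ
    · have hev : v =ᶠ[𝓝 θ] g :=
        Filter.eventuallyEq_of_mem (Ioi_mem_nhds hB) fun y hy ↦ hvg y (le_of_lt hy)
      rw [hev.deriv_eq] at hd1
      exact (hg' θ (le_of_lt hB)).ne hd1
    push Not at hA hB
    exact (deriv_smoothStep_pos h1 ⟨by linarith, by linarith⟩).ne' hd0
  refine ⟨c, hcs, hleft, hright, fun θ hθ' ↦ ?_, fun θ ↦ ?_, fun θ ↦ ?_, hinj, hreg⟩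
  · rw [hc0]; exact smoothStep_mem_Ioo h1 hθ'
  · rw [hc0]; exact smoothStep_mem_Icc _ _ _
  · rw [hc1]
    exact combo_mem_uIcc (smoothStep_mem_Icc _ _ _).1 (smoothStep_mem_Icc _ _ _).2

/-! ### Monotone blending of two increasing (or two decreasing) functions -/

/-- **Monotone blending.** If `p₁ ≤ p₂` on `[a, b]` and both have positive derivative there, the
blend `H = (1 - χ) p₁ + χ p₂` along the smooth step `χ` from `a` to `b` is `C^∞`, equals `p₁`
left of `a` and `p₂` right of `b`, has positive derivative on `[a, b]`
(`H' = (1 - χ) p₁' + χ p₂' + χ' (p₂ - p₁)`), and lies between `p₁` and `p₂`. [folklore] -/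
theorem exists_blend_deriv_pos {a b : ℝ} (hab : a < b) {p₁ p₂ : ℝ → ℝ} (h₁ : ContDiff ℝ ∞ p₁)
    (h₂ : ContDiff ℝ ∞ p₂) (hle : ∀ t ∈ Icc a b, p₁ t ≤ p₂ t)
    (h₁' : ∀ t ∈ Icc a b, 0 < deriv p₁ t) (h₂' : ∀ t ∈ Icc a b, 0 < deriv p₂ t) :
    ∃ H : ℝ → ℝ, ContDiff ℝ ∞ H ∧ (∀ t, t ≤ a → H t = p₁ t) ∧ (∀ t, b ≤ t → H t = p₂ t) ∧
      (∀ t ∈ Icc a b, 0 < deriv H t) ∧ ∀ t, H t ∈ uIcc (p₁ t) (p₂ t) := by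
  set χ := smoothStep a b with hχ
  set H : ℝ → ℝ := fun t ↦ (1 - χ t) * p₁ t + χ t * p₂ t with hH
  have hχs : ContDiff ℝ ∞ χ := contDiff_smoothStep a b
  have hHs : ContDiff ℝ ∞ H := ((contDiff_const.sub hχs).mul h₁).add (hχs.mul h₂)
  refine ⟨H, hHs, fun t ht ↦ ?_, fun t ht ↦ ?_, fun t ht ↦ ?_, fun t ↦ ?_⟩
  · have hχt : χ t = 0 := smoothStep_of_le hab ht
    simp only [hH, hχt]; ring
  · have hχt : χ t = 1 := smoothStep_of_ge hab ht
    simp only [hH, hχt]; ring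
  · have hd : HasDerivAt H ((-(deriv χ t)) * p₁ t + (1 - χ t) * deriv p₁ t +
        (deriv χ t * p₂ t + χ t * deriv p₂ t)) t := by
      have hχd := (differentiable_smoothStep a b t).hasDerivAt
      have hp₁ := (h₁.differentiable (by simp) t).hasDerivAt
      have hp₂ := (h₂.differentiable (by simp) t).hasDerivAt
      exact ((hχd.const_sub 1).mul hp₁).add (hχd.mul hp₂)
    rw [hd.deriv]
    have hχ0 : 0 ≤ χ t := (smoothStep_mem_Icc a b t).1
    have hχ1 : χ t ≤ 1 := (smoothStep_mem_Icc a b t).2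
    have hχ' : 0 ≤ deriv χ t := deriv_smoothStep_nonneg hab t
    have hp := hle t ht
    have hq₁ := h₁' t ht
    have hq₂ := h₂' t ht
    have : -deriv χ t * p₁ t + (1 - χ t) * deriv p₁ t + (deriv χ t * p₂ t + χ t * deriv p₂ t) =
        (1 - χ t) * deriv p₁ t + χ t * deriv p₂ t + deriv χ t * (p₂ t - p₁ t) := by ring
    rw [this]
    have h3 : 0 ≤ deriv χ t * (p₂ t - p₁ t) := mul_nonneg hχ' (by linarith)
    rcases hχ1.lt_or_eq with hlt | heq
    · nlinarith
    · rw [heq]; nlinarith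
  · exact combo_mem_uIcc (smoothStep_mem_Icc a b t).1 (smoothStep_mem_Icc a b t).2

/-- **Antitone blending**: the same for two decreasing functions with `p₂ ≤ p₁` on `[a, b]`
(`H' = (1 - χ) p₁' + χ p₂' + χ' (p₂ - p₁) < 0`). [folklore] -/
theorem exists_blend_deriv_neg {a b : ℝ} (hab : a < b) {p₁ p₂ : ℝ → ℝ} (h₁ : ContDiff ℝ ∞ p₁)
    (h₂ : ContDiff ℝ ∞ p₂) (hle : ∀ t ∈ Icc a b, p₂ t ≤ p₁ t)
    (h₁' : ∀ t ∈ Icc a b, deriv p₁ t < 0) (h₂' : ∀ t ∈ Icc a b, deriv p₂ t < 0) :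
    ∃ H : ℝ → ℝ, ContDiff ℝ ∞ H ∧ (∀ t, t ≤ a → H t = p₁ t) ∧ (∀ t, b ≤ t → H t = p₂ t) ∧
      (∀ t ∈ Icc a b, deriv H t < 0) ∧ ∀ t, H t ∈ uIcc (p₁ t) (p₂ t) := by
  obtain ⟨H, hHs, hl, hr, hd, hu⟩ := exists_blend_deriv_pos hab h₁.neg h₂.neg
    (fun t ht ↦ neg_le_neg (hle t ht))
    (fun t ht ↦ by rw [deriv.fun_neg]; linarith [h₁' t ht])
    (fun t ht ↦ by rw [deriv.fun_neg]; linarith [h₂' t ht])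
  refine ⟨fun t ↦ -H t, hHs.neg, fun t ht ↦ by simp only [hl t ht, neg_neg],
    fun t ht ↦ by simp only [hr t ht, neg_neg], fun t ht ↦ ?_, fun t ↦ ?_⟩
  · rw [deriv.fun_neg]; linarith [hd t ht]
  · have := hu t
    show -H t ∈ uIcc (p₁ t) (p₂ t)
    rw [mem_uIcc] at this ⊢
    rcases this with h | h
    · right; constructor <;> linarith [h.1, h.2]
    · left; constructor <;> linarith [h.1, h.2]

/-! ### Smooth clamps -/

/-- **A smooth clamp**: for `a < a' < b' < b` there is a `C^∞` function `σ : ℝ → ℝ` which is the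
identity on `[a', b']` and takes all its values in `(a, b)` (indeed in a compact subinterval).
Used to turn functions smooth on an open interval into globally smooth ones without changing
them on a compact subinterval. [folklore] -/
theorem exists_contDiff_clamp {a a' b' b : ℝ} (h₁ : a < a') (h₂ : a' ≤ b') (h₃ : b' < b) :
    ∃ σ : ℝ → ℝ, ContDiff ℝ ∞ σ ∧ (∀ t ∈ Icc a' b', σ t = t) ∧ ∀ t, σ t ∈ Ioo a b := by
  set c₁ := (2 * a + a') / 3 with hc₁
  set a₁ := (a + 2 * a') / 3 with ha₁
  set b₁ := (2 * b' + b) / 3 with hb₁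
  set c₂ := (b' + 2 * b) / 3 with hc₂
  have hca : a < c₁ := by rw [hc₁]; linarith
  have hc₁a₁ : c₁ < a₁ := by rw [hc₁, ha₁]; linarith
  have ha₁a' : a₁ < a' := by rw [ha₁]; linarith
  have hb'b₁ : b' < b₁ := by rw [hb₁]; linarith
  have hb₁c₂ : b₁ < c₂ := by rw [hb₁, hc₂]; linarith
  have hc₂b : c₂ < b := by rw [hc₂]; linarith
  set χ₁ := smoothStep a₁ a' with hχ₁
  set χ₂ := smoothStep b' b₁ with hχ₂
  set σ : ℝ → ℝ := fun t ↦ (1 - χ₁ t) * c₁ + χ₁ t * ((1 - χ₂ t) * t + χ₂ t * c₂) with hσ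
  have hχ₁s : ContDiff ℝ ∞ χ₁ := contDiff_smoothStep _ _
  have hχ₂s : ContDiff ℝ ∞ χ₂ := contDiff_smoothStep _ _
  refine ⟨σ, ?_, fun t ht ↦ ?_, fun t ↦ ?_⟩
  · exact ((contDiff_const.sub hχ₁s).mul contDiff_const).add
      (hχ₁s.mul (((contDiff_const.sub hχ₂s).mul contDiff_id).add (hχ₂s.mul contDiff_const)))
  · have e₁ : χ₁ t = 1 := smoothStep_of_ge ha₁a' ht.1
    have e₂ : χ₂ t = 0 := smoothStep_of_le hb'b₁ ht.2
    simp only [hσ, e₁, e₂]; ring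
  · -- the inner blend lies between `t` and `c₂`, the outer between `c₁` and the inner one
    have hin : (1 - χ₂ t) * t + χ₂ t * c₂ ∈ uIcc t c₂ :=
      combo_mem_uIcc (smoothStep_mem_Icc _ _ _).1 (smoothStep_mem_Icc _ _ _).2
    have hout : σ t ∈ uIcc c₁ ((1 - χ₂ t) * t + χ₂ t * c₂) :=
      combo_mem_uIcc (smoothStep_mem_Icc _ _ _).1 (smoothStep_mem_Icc _ _ _).2
    rcases lt_or_ge t a₁ with hta | hta
    · -- left: `σ t = c₁`
      have e₁ : χ₁ t = 0 := smoothStep_of_le ha₁a' hta.le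
      have : σ t = c₁ := by simp only [hσ, e₁]; ring
      rw [this]; exact ⟨hca, by linarith⟩
    rcases le_or_gt t b₁ with htb | htb
    · -- middle: `t ∈ [a₁, b₁]`, inner blend in `[a₁, c₂]`
      have hin' : (1 - χ₂ t) * t + χ₂ t * c₂ ∈ Icc a₁ c₂ := by
        rw [mem_uIcc] at hin
        rcases hin with h | h <;> constructor <;> linarith [h.1, h.2]
      rw [mem_uIcc] at hout
      rcases hout with h | h <;> constructor <;> linarith [h.1, h.2, hin'.1, hin'.2]
    · -- right: `σ t = c₂`
      have e₁ : χ₁ t = 1 := smoothStep_of_ge ha₁a' (by linarith)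
      have e₂ : χ₂ t = 1 := smoothStep_of_ge hb'b₁ htb.le
      have : σ t = c₂ := by simp only [hσ, e₁, e₂]; ring
      rw [this]; exact ⟨by linarith, hc₂b⟩

end Literature.Topology.FourManifolds
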